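import Literature.NumberTheory.EllipticCurves.PAdicLFunctionTameMinus
import Literature.NumberTheory.EllipticCurves.PAdicLFunctionTameDistributionProofs
import Literature.NumberTheory.EllipticCurves.PAdicLFunctionMinusDistributionProofs
import Literature.NumberTheory.EllipticCurves.PAdicLFunctionMinusDenominatorsProofs
import Literature.NumberTheory.EllipticCurves.PAdicMeasureTransform
import HarnessLib

/-!
# The minus tame measure `μ⁻_{f,α,m}` is a bounded distribution; its `χ`-weighted Riemann sums converge (PROOFS ONLY)

`Proofs` companion (theorems only; no definition, no named fact) of `PAdicLFunctionTameMinus` (the MINUS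
Mazur–Tate–Teitelbaum measure at tame level `m`, `msdMeasureTameMinus`, and `L⁻_p(f, α, χ, T) = padicLFunctionTameMinus`),
the minus twins of `PAdicLFunctionTameDistributionProofs.sum_filter_msdMeasureTame_succ` and of
`PAdicLFunctionTameConvergenceProofs` (`sum_filter_weighted_msdMeasureTame_succ`, `exists_norm_weighted_msdMeasureTame_le`,
`tendsto_padicLRiemannSumTame_holds`), proved word for word with the minus Hecke relation
`a_p [r]⁻ = ∑_{u mod p} [(r+u)/p]⁻ + [p r]⁻` (`intCast_mul_ratMinusSymbol`, MTT (4.2) + §I.8), the periodicity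
`[r + n]⁻ = [r]⁻` (`ratMinusSymbol_add_intCast`) and the common denominator of the minus symbols
(`exists_forall_ratMinusSymbol_eq_div_of_maninDrinfeld`, Manin–Drinfeld):

* `ratMinusSymbol_mul_div_eq_of_dvd_sub` — `M ∣ c − c' ⇒ [k c/M]⁻ = [k c'/M]⁻`;
* **`sum_filter_msdMeasureTameMinus_succ`** — the distribution relation in the `p`-direction (MTT §I.10 Prop. (10.2))
  `∑_{a' ↦ a} μ⁻_{f,α,m}((a' + pⁿ⁺¹ℤ_p) × {b}) = μ⁻_{f,α,m}((a + pⁿℤ_p) × {b})`;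
* `padicLRiemannSumTameMinus_eq_sum_weighted`, **`sum_filter_weighted_msdMeasureTameMinus_succ`**,
  **`exists_norm_weighted_msdMeasureTameMinus_le`** — the `χ`-weighted family `a ↦ Σ_b χ(b) μ⁻_{f,α,m}((a + pⁿℤ_p) × {b})` is a
  bounded distribution for `‖α‖ = 1`;
* **`tendsto_padicLRiemannSumTameMinus`** — its Riemann sums converge to the coefficients of `L⁻_p(f, α, χ, T)`
  (`tendsto_riemannSum_of_distribution`, MTT §I.11–I.13).

References: B. Mazur, J. Tate, J. Teitelbaum, Invent. Math. 84 (1986) §I.4 (4.2), §I.8, §I.10 (10.1)–(10.2), §I.11–I.13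
[MazurTateTeitelbaum1986Invent]; K. Matsuno, J. Number Theory 84 (2000) §2 [Matsuno2000]; Ju. I. Manin (1972) Cor. 3.6
[Manin1972].
-/

noncomputable section

open scoped MatrixGroups ModularForm

open CongruenceSubgroup Filter Topology Literature.NumberTheory.EllipticCurves.ModularForms

namespace Literature.NumberTheory.EllipticCurves

/-! ## Periodicity and the distribution relation -/

section Distribution

variable {p m n : ℕ}

/-- Two naturals with the same residues mod `pᵏ` and mod `m` (coprime) agree mod `pᵏm`. [folklore] -/
private theorem intCast_dvd_sub_of_natCast_eq_minus {k : ℕ} (hmp : m.Coprime p) {c c' : ℕ}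
    (h1 : (c : ZMod (p ^ k)) = c') (h2 : (c : ZMod m) = c') :
    ((p ^ k * m : ℕ) : ℤ) ∣ (c : ℤ) - c' := by
  have h1' : c ≡ c' [MOD p ^ k] := (ZMod.natCast_eq_natCast_iff _ _ _).mp h1
  have h2' : c ≡ c' [MOD m] := (ZMod.natCast_eq_natCast_iff _ _ _).mp h2
  have h : c ≡ c' [MOD p ^ k * m] :=
    (Nat.modEq_and_modEq_iff_modEq_mul (hmp.symm.pow_left k)).mp ⟨h1', h2'⟩
  exact Nat.modEq_iff_dvd.mp h.symm

variable {N : ℕ} [NeZero N] (f : CuspForm (Gamma0 N) 2)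

/-- `[r]⁻_f` only depends on `r mod ℤ` (tree `ratMinusSymbol_add_intCast`, MTT §I.4 (4.2) for `{∞, ·}`):
`M ∣ c − c'` gives `[k c/M]⁻ = [k c'/M]⁻`. [cite: MazurTateTeitelbaum1986Invent, §I.4 (4.2) and §I.8] -/
theorem ratMinusSymbol_mul_div_eq_of_dvd_sub {M : ℕ} (hM : M ≠ 0) {c c' : ℤ} (h : (M : ℤ) ∣ c - c') (k : ℕ) :
    ratMinusSymbol f ((k : ℚ) * ((c : ℚ) / M)) = ratMinusSymbol f ((k : ℚ) * ((c' : ℚ) / M)) := by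
  obtain ⟨e, he⟩ := h
  have hM' : (M : ℚ) ≠ 0 := by exact_mod_cast hM
  have : (k : ℚ) * ((c : ℚ) / M) = (k : ℚ) * ((c' : ℚ) / M) + (((k : ℤ) * e : ℤ) : ℚ) := by
    have hc : (c : ℚ) = c' + M * e := by exact_mod_cast (sub_eq_iff_eq_add'.mp he)
    rw [hc]
    push_cast
    field_simp
  rw [this, ratMinusSymbol_add_intCast]

/-- **The distribution relation of the minus measure at tame level `m`** (MTT §I.10 Prop. (10.2), minus part): for a
rational normalised newform `f` of level `N` prime to `p`, `(m, p) = 1`, `a_p(f) = a_p`, `α ≠ 0` with `α² − a_p α + p = 0`: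
`∑_{a' ↦ a} μ⁻_{f,α,m}((a' + pⁿ⁺¹ℤ_p) × {b}) = μ⁻_{f,α,m}((a + pⁿℤ_p) × {b})` — uniformly in `n`: the `p` lifted fractions
are `(x + u)/p`, `x = c/(pⁿm)`, the minus Hecke relation at `p` gives `∑_u [(x+u)/p]⁻ = a_p[x]⁻ − [px]⁻`, `∑_u [x + u]⁻ = p[x]⁻`,
and `α⁻¹a_p − pα⁻² = 1`. Word for word the proof of `sum_filter_msdMeasureTame_succ`.
[cite: MazurTateTeitelbaum1986Invent, §I.10 Prop. (10.2) (p. 13)] -/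
theorem sum_filter_msdMeasureTameMinus_succ [Fact p.Prime] [NeZero m] (hf : IsNewform0 f)
    (hrat : ∀ r : ℚ, (ratMinusSymbol f r : ℝ) = normalizedMinusSymbol f r) (hpN : ¬ p ∣ N) (hmp : m.Coprime p)
    {ap : ℤ} (hap : cuspCoeff f p = ap) {α : ℚ_[p]} (hα₀ : α ≠ 0) (hα : α ^ 2 - ap * α + p = 0)
    (n : ℕ) (a : ZMod (p ^ n)) (b : ZMod m) :
    ∑ a' ∈ Finset.univ.filter (fun a' : ZMod (p ^ (n + 1)) =>
        ZMod.castHom (pow_dvd_pow p n.le_succ) (ZMod (p ^ n)) a' = a), msdMeasureTameMinus f m α (n + 1) a' b =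
      msdMeasureTameMinus f m α n a b := by
  classical
  have hp : p.Prime := Fact.out
  haveI : NeZero (p ^ (n + 1)) := ⟨pow_ne_zero _ hp.ne_zero⟩
  have hM1 : p ^ (n + 1) * m ≠ 0 := mul_ne_zero (pow_ne_zero _ hp.ne_zero) (NeZero.ne m)
  have hp0 : (p : ℚ) ≠ 0 := by exact_mod_cast hp.ne_zero
  have hpn0 : (p : ℚ) ^ n ≠ 0 := pow_ne_zero _ hp0
  have hm0 : (m : ℚ) ≠ 0 := by exact_mod_cast (NeZero.ne m)
  set c := tameRep p m n a b with hc
  set x : ℚ := tameFraction p m n a b with hx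
  rw [filter_castHom_succ_eq_image_plift hmp a b,
    Finset.sum_image fun u _ u' _ h => plift_injective (n := n) hmp c h]
  -- each lifted fraction is `(x + u)/p` mod `ℤ` (`k = 1`) and `p·` it is `x + u` (`k = p`)
  have hfrac : ∀ u : Fin p, ∀ k : ℕ, ratMinusSymbol f ((k : ℚ) *
      tameFraction p m (n + 1) ((c + p ^ n * m * (u : ℕ) : ℕ) : ZMod (p ^ (n + 1))) b) =
      ratMinusSymbol f ((k : ℚ) * (((c + p ^ n * m * (u : ℕ) : ℕ) : ℚ) / ((p : ℚ) ^ (n + 1) * m))) := by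
    intro u k
    set a' : ZMod (p ^ (n + 1)) := ((c + p ^ n * m * (u : ℕ) : ℕ) : ZMod (p ^ (n + 1))) with ha'
    set c' := tameRep p m (n + 1) a' b with hc'
    have h1 : (c' : ZMod (p ^ (n + 1))) = ((c + p ^ n * m * (u : ℕ) : ℕ) : ZMod (p ^ (n + 1))) := by
      rw [hc', natCast_tameRep_left hp hmp]
    have h2 : (c' : ZMod m) = ((c + p ^ n * m * (u : ℕ) : ℕ) : ZMod m) := by
      rw [hc', natCast_tameRep_right hmp, Nat.cast_add, hc, natCast_tameRep_right hmp]
      push_cast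
      rw [ZMod.natCast_self, mul_zero, zero_mul, add_zero]
    have hdvd := intCast_dvd_sub_of_natCast_eq_minus (k := n + 1) hmp h1 h2
    have hL : (k : ℚ) * tameFraction p m (n + 1) a' b = (k : ℚ) * (((c' : ℤ) : ℚ) / ((p ^ (n + 1) * m : ℕ) : ℚ)) := by
      rw [tameFraction, ← hc']
      push_cast
      ring
    have hR : (k : ℚ) * (((c + p ^ n * m * (u : ℕ) : ℕ) : ℚ) / ((p : ℚ) ^ (n + 1) * m)) =
        (k : ℚ) * ((((c + p ^ n * m * (u : ℕ) : ℕ) : ℤ) : ℚ) / ((p ^ (n + 1) * m : ℕ) : ℚ)) := by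
      push_cast
      ring
    rw [hL, hR]
    exact ratMinusSymbol_mul_div_eq_of_dvd_sub f hM1 hdvd k
  have hone : ∀ u : Fin p, ratMinusSymbol f
      (tameFraction p m (n + 1) ((c + p ^ n * m * (u : ℕ) : ℕ) : ZMod (p ^ (n + 1))) b) =
      ratMinusSymbol f ((x + u) / p) := by
    intro u
    have h := hfrac u 1
    rw [Nat.cast_one, one_mul, one_mul] at h
    rw [h, hx, tameFraction]
    congr 1
    push_cast
    field_simp
    ring
  have hpee : ∀ u : Fin p, ratMinusSymbol f ((p : ℚ) *
      tameFraction p m (n + 1) ((c + p ^ n * m * (u : ℕ) : ℕ) : ZMod (p ^ (n + 1))) b) =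
      ratMinusSymbol f x := by
    intro u
    rw [hfrac u p]
    have : (p : ℚ) * (((c + p ^ n * m * (u : ℕ) : ℕ) : ℚ) / ((p : ℚ) ^ (n + 1) * m)) = x + ((u : ℕ) : ℤ) := by
      rw [hx, tameFraction]
      push_cast
      field_simp
      ring
    rw [this, ratMinusSymbol_add_intCast]
  have hHecke := intCast_mul_ratMinusSymbol p hf hp hpN hap hrat x
  have hkey : α⁻¹ * (ap : ℚ_[p]) - (p : ℚ_[p]) * α⁻¹ ^ 2 = 1 := by
    field_simp
    linear_combination -hα
  have hsumq : ∑ u : Fin p, ratMinusSymbol f ((x + u) / p) =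
      (ap : ℚ) * ratMinusSymbol f x - ratMinusSymbol f (p * x) := eq_sub_of_add_eq hHecke.symm
  simp only [msdMeasureTameMinus, hone, hpee, Finset.sum_sub_distrib, ← Finset.mul_sum]
  rw [← Rat.cast_sum, hsumq, Finset.sum_const, Finset.card_univ, Fintype.card_fin, nsmul_eq_mul, ← hx]
  push_cast
  linear_combination (α⁻¹ ^ n * (ratMinusSymbol f x : ℚ_[p])) * hkey

end Distribution

/-! ## The `χ`-weighted minus tame measure: fibre relation, bound, convergence -/

section Weighted

variable {N : ℕ} [NeZero N] (f : CuspForm (Gamma0 N) 2) {p : ℕ} [Fact p.Prime] {m : ℕ} [NeZero m]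

omit [NeZero N] in
/-- The minus tame Riemann sum is the Riemann sum of the `χ`-weighted family
`a ↦ ∑_{b mod m} χ(b) μ⁻_{f,α,m}((a + pⁿℤ_p) × {b})` (re-bracketing). [cite: MazurTateTeitelbaum1986Invent, §I.13 (pp. 18–19)] -/
theorem padicLRiemannSumTameMinus_eq_sum_weighted (α : ℚ_[p]) (χ : DirichletCharacter ℚ_[p] m) (k n : ℕ) :
    padicLRiemannSumTameMinus f m α χ k n =
      ∑ᶠ ζ : rootsOfUnity (torsionOrder p) ℤ_[p], ∑ s : ZMod (p ^ n),
        (fun (n : ℕ) (a : ZMod (p ^ n)) ↦ ∑ b : ZMod m, χ b * msdMeasureTameMinus f m α n a b)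
          (n + cyclotomicExponent p)
          (PadicInt.toZModPow (n + cyclotomicExponent p) ((ζ : ℤ_[p]ˣ) : ℤ_[p]) *
            (cyclotomicGenerator p : ZMod (p ^ (n + cyclotomicExponent p))) ^ s.val) *
          (s.val.choose k : ℚ_[p]) := by
  unfold padicLRiemannSumTameMinus
  refine finsum_congr fun ζ ↦ Finset.sum_congr rfl fun s _ ↦ ?_
  rw [Finset.sum_mul]

/-- **Fibre relation of the `χ`-weighted minus tame measure** (sum of `sum_filter_msdMeasureTameMinus_succ` over `b mod m`).
[cite: MazurTateTeitelbaum1986Invent, §I.10 Prop. (10.2) (p. 13)] -/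
theorem sum_filter_weighted_msdMeasureTameMinus_succ (hf : IsNewform0 f)
    (hrat : ∀ r : ℚ, (ratMinusSymbol f r : ℝ) = normalizedMinusSymbol f r) (hpN : ¬ p ∣ N) (hmp : m.Coprime p)
    {ap : ℤ} (hap : cuspCoeff f p = ap) {α : ℚ_[p]} (hα₀ : α ≠ 0) (hα : α ^ 2 - ap * α + p = 0)
    (χ : DirichletCharacter ℚ_[p] m) (n : ℕ) (a : ZMod (p ^ n)) :
    ∑ a' ∈ Finset.univ.filter (fun a' : ZMod (p ^ (n + 1)) ↦
        ZMod.castHom (pow_dvd_pow p n.le_succ) (ZMod (p ^ n)) a' = a),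
        (∑ b : ZMod m, χ b * msdMeasureTameMinus f m α (n + 1) a' b) =
      ∑ b : ZMod m, χ b * msdMeasureTameMinus f m α n a b := by
  rw [Finset.sum_comm]
  refine Finset.sum_congr rfl fun b _ ↦ ?_
  rw [← Finset.mul_sum, sum_filter_msdMeasureTameMinus_succ f hf hrat hpN hmp hap hα₀ hα n a b]

omit [NeZero N] in
/-- A value of a `ℚ_p`-valued Dirichlet character has norm `≤ 1` (it is `0` or a root of unity). [folklore] -/
private theorem norm_dirichletCharacter_apply_le_one' (χ : DirichletCharacter ℚ_[p] m) (b : ZMod m) : ‖χ b‖ ≤ 1 := by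
  by_cases hb : IsUnit b
  · obtain ⟨u, rfl⟩ := hb
    have hfin : IsOfFinOrder (χ.toUnitHom u) := MonoidHom.isOfFinOrder _ (isOfFinOrder_of_finite u)
    obtain ⟨k, hk, hpow⟩ := hfin.exists_pow_eq_one
    have hval : (χ (u : ZMod m)) ^ k = 1 := by
      have := congr_arg (fun x : ℚ_[p]ˣ ↦ (x : ℚ_[p])) hpow
      simpa [MulChar.coe_toUnitHom] using this
    have hn : ‖χ (u : ZMod m)‖ ^ k = 1 := by rw [← norm_pow, hval, norm_one]
    exact (pow_eq_one_iff_of_nonneg (norm_nonneg _) hk.ne').mp hn |>.le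
  · rw [χ.map_nonunit hb, norm_zero]
    exact zero_le_one

/-- **Boundedness of the `χ`-weighted minus tame measure** for `‖α‖ = 1`: the `[r]⁻_f` have ONE common denominator for all
`r ∈ ℚ` (Manin–Drinfeld, `exists_forall_ratMinusSymbol_eq_div_of_maninDrinfeld`), so `‖μ⁻_{f,α,m}(·)‖ ≤ 2‖1/D‖`, and the
same bound holds for the weighted sum (ultrametric, `‖χ(b)‖ ≤ 1`). [cite: MazurTateTeitelbaum1986Invent, §I.11 (pp. 13–14)]
[cite: Manin1972, Cor. 3.6] -/
theorem exists_norm_weighted_msdMeasureTameMinus_le (hMD : exists_nsmul_modularSymbol_mem_periodLattice f) {α : ℚ_[p]}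
    (hαu : ‖α‖ = 1) (χ : DirichletCharacter ℚ_[p] m) :
    ∃ C : ℝ, ∀ (n : ℕ) (a : ZMod (p ^ n)), ‖∑ b : ZMod m, χ b * msdMeasureTameMinus f m α n a b‖ ≤ C := by
  classical
  obtain ⟨D, hD, hden⟩ := exists_forall_ratMinusSymbol_eq_div_of_maninDrinfeld hMD
  set C : ℝ := ‖(D : ℚ_[p])‖⁻¹ with hC
  have hC0 : 0 ≤ C := inv_nonneg.mpr (norm_nonneg _)
  have hbd : ∀ r : ℚ, ‖(ratMinusSymbol f r : ℚ_[p])‖ ≤ C := fun r ↦ by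
    obtain ⟨z, hz⟩ := hden r
    rw [hz]
    push_cast
    rw [norm_div, div_eq_mul_inv]
    exact mul_le_of_le_one_left hC0 (Padic.norm_int_le_one z)
  have hαi : ‖α⁻¹‖ = 1 := by rw [norm_inv, hαu, inv_one]
  have hμ : ∀ (n : ℕ) (a : ZMod (p ^ n)) (b : ZMod m), ‖msdMeasureTameMinus f m α n a b‖ ≤ 2 * C := by
    intro n a b
    rw [msdMeasureTameMinus]
    calc _ ≤ ‖α⁻¹ ^ n * (ratMinusSymbol f (tameFraction p m n a b) : ℚ_[p])‖ +
          ‖α⁻¹ ^ (n + 1) * (ratMinusSymbol f ((p : ℚ) * tameFraction p m n a b) : ℚ_[p])‖ := norm_sub_le _ _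
      _ ≤ C + C := by
          refine add_le_add ?_ ?_ <;>
          · rw [norm_mul, norm_pow, hαi, one_pow, one_mul]
            exact hbd _
      _ = 2 * C := by ring
  refine ⟨2 * C, fun n a ↦ IsUltrametricDist.norm_sum_le_of_forall_le_of_nonneg (by positivity) fun b _ ↦ ?_⟩
  rw [norm_mul]
  calc ‖χ b‖ * ‖msdMeasureTameMinus f m α n a b‖ ≤ 1 * (2 * C) :=
        mul_le_mul (norm_dirichletCharacter_apply_le_one' χ b) (hμ n a b) (norm_nonneg _) zero_le_one
    _ = 2 * C := one_mul _

/-- **The minus tame Riemann sums converge** (Mazur–Tate–Teitelbaum §I.11–I.13 at tame level `m`, minus part): for a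
rational normalised newform `f` of level `N` prime to `p`, `(m, p) = 1`, `a_p(f) = a_p`, `α` with `α² − a_p α + p = 0`,
`‖α‖ = 1`, and every `χ` mod `m` with values in `ℚ_p`, `padicLRiemannSumTameMinus f m α χ k n → padicLCoeffTameMinus f m α χ k`.
[cite: MazurTateTeitelbaum1986Invent, §I.11–I.13 (pp. 13–19)] -/
theorem tendsto_padicLRiemannSumTameMinus (hf : IsNewform0 f) (hQ : coeffField f = ⊥) (hpN : ¬ p ∣ N)
    (hmp : m.Coprime p) {ap : ℤ} (hap : cuspCoeff f p = ap) {α : ℚ_[p]} (hα : α ^ 2 - ap * α + p = 0)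
    (hαu : ‖α‖ = 1) (χ : DirichletCharacter ℚ_[p] m) (k : ℕ) :
    Tendsto (padicLRiemannSumTameMinus f m α χ k) atTop (𝓝 (padicLCoeffTameMinus f m α χ k)) := by
  have hα0 : α ≠ 0 := norm_ne_zero_iff.mp (by rw [hαu]; exact one_ne_zero)
  have hdist := sum_filter_weighted_msdMeasureTameMinus_succ f hf (ratCast_ratMinusSymbol f hf hQ) hpN hmp hap hα0 hα χ
  obtain ⟨C, hC⟩ := exists_norm_weighted_msdMeasureTameMinus_le f
    (exists_nsmul_modularSymbol_mem_periodLattice_of_isNewform0 hf hQ) hαu χ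
  exact tendsto_riemannSum_of_distribution
    (μ := fun (n : ℕ) (a : ZMod (p ^ n)) ↦ ∑ b : ZMod m, χ b * msdMeasureTameMinus f m α n a b)
    (RS := fun k n ↦ padicLRiemannSumTameMinus f m α χ k n)
    (fun k n ↦ padicLRiemannSumTameMinus_eq_sum_weighted f α χ k n) hdist hC k

end Weighted

end Literature.NumberTheory.EllipticCurves

end
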